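import Literature.Analysis.Calculus.JointSmoothnessPartialsWithin
import Mathlib.Analysis.Calculus.UniformLimitsDeriv
import Mathlib.MeasureTheory.Integral.IntervalIntegral.FundThmCalculus
import Mathlib.Topology.UniformSpace.UniformApproximation
import HarnessLib

/-!
# Uniform limits of slab-smooth families (topic `Analysis/Calculus`)

Analytic layer of the programme to prove short-time existence for quasilinear strictly
parabolic systems on a closed manifold (hypothesis `hQL` of
`Literature.Geometry.Riemannian.ricciFlow_shortTime_existence_of_quasilinear`). Both the
linear existence theorem (approximate solutions that are Cauchy at every order) and the
quasilinear iteration of that programme produce the solution as a limit of functions which are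
smooth on a CLOSED time slab `[0, T] × E`; this file proves that such limits are again smooth on
the closed slab, with all mixed derivatives converging:

* `hasDerivWithinAt_of_tendstoUniformlyOn_Icc` — the one-variable uniform-limit theorem WITHIN
  a closed interval (one-sided at the ends): if `fₙ` has derivative `fₙ'` within `[a, b]`,
  `fₙ' → g'` uniformly on `[a, b]` with `fₙ'` continuous, and `fₙ → g` pointwise, then `g` has
  derivative `g'` within `[a, b]` (fundamental theorem of calculus);
* `contDiff_of_tendstoUniformly_iteratedFDeriv` — if all iterated derivatives of smooth `fₙ`
  converge uniformly, the pointwise limit is smooth and its iterated derivatives are the limits;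
* `slab_uniform_limit` — for a sequence of families `w N l` (`l` = order of the time derivative)
  with the mixed-partials structure of `contDiffOn_uncurry_of_mixed_partials_within` on the slab
  and all mixed derivatives uniformly Cauchy on the slab, the limit family has the same
  structure, is smooth on the closed slab, and all mixed derivatives converge uniformly.

Everything is proved; no named fact and no `sorry` is introduced.

## References

* J. Dieudonné, *Foundations of Modern Analysis*, Academic Press 1960, (8.6.3)–(8.6.4)
  (limits of sequences of differentiable functions). [Dieudonne1960]
-/

noncomputable section

open Set Function Filter Topology MeasureTheory intervalIntegral
open scoped ContDiff Topology

namespace Literature.Analysis.Calculus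

variable {E : Type*} [NormedAddCommGroup E] [NormedSpace ℝ E]
variable {F : Type*} [NormedAddCommGroup F] [NormedSpace ℝ F] [CompleteSpace F]

/-! ### One variable: uniform limits within a closed interval -/

section OneVariable

variable {G : Type*} [NormedAddCommGroup G] [NormedSpace ℝ G] [CompleteSpace G]

/-- Fundamental theorem of calculus within a closed interval: if `f` has derivative `f'` within
`[a, b]` at every point of `[a, b]` and `f'` is continuous on `[a, b]`, then
`f t = f a + ∫_a^t f'` for `t ∈ [a, b]`. [folklore] -/
theorem eq_add_integral_of_hasDerivWithinAt_Icc {a b : ℝ} {f f' : ℝ → G}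
    (hf : ∀ t ∈ Icc a b, HasDerivWithinAt f (f' t) (Icc a b) t) (hf'c : ContinuousOn f' (Icc a b))
    {t : ℝ} (ht : t ∈ Icc a b) : f t = f a + ∫ s in a..t, f' s := by
  have hsub : Icc a t ⊆ Icc a b := Icc_subset_Icc_right ht.2
  have hcont : ContinuousOn f (Icc a t) := fun s hs ↦
    ((hf s (hsub hs)).continuousWithinAt).mono hsub
  have hderiv : ∀ s ∈ Ioo a t, HasDerivWithinAt f (f' s) (Ioi s) s := by
    intro s hs
    refine (hf s (hsub (Ioo_subset_Icc_self hs))).mono_of_mem_nhdsWithin ?_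
    exact mem_nhdsWithin.2 ⟨Iio b, isOpen_Iio, hs.2.trans_le ht.2,
      fun u hu ↦ ⟨(hs.1.trans hu.2).le, le_of_lt hu.1⟩⟩
  have hint : IntervalIntegrable f' volume a t :=
    (hf'c.mono hsub).intervalIntegrable_of_Icc ht.1
  rw [integral_eq_sub_of_hasDeriv_right_of_le ht.1 hcont hderiv hint]
  abel

/-- **Uniform limits within a closed interval**: if `fₙ` has derivative `fₙ'` within `[a, b]`,
the `fₙ'` are continuous on `[a, b]` and converge uniformly on `[a, b]` to `g'`, and `fₙ → g`
pointwise on `[a, b]`, then `g` has derivative `g'` within `[a, b]` at every point of `[a, b]`.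
[cite: Dieudonne1960, (8.6.3)] -/
theorem hasDerivWithinAt_of_tendstoUniformlyOn_Icc {a b : ℝ} {f f' : ℕ → ℝ → G} {g g' : ℝ → G}
    (hf : ∀ n, ∀ t ∈ Icc a b, HasDerivWithinAt (f n) (f' n t) (Icc a b) t)
    (hf'c : ∀ n, ContinuousOn (f' n) (Icc a b))
    (hfg : ∀ t ∈ Icc a b, Tendsto (fun n ↦ f n t) atTop (𝓝 (g t)))
    (hf'g' : TendstoUniformlyOn f' g' atTop (Icc a b)) {t : ℝ} (ht : t ∈ Icc a b) :
    HasDerivWithinAt g (g' t) (Icc a b) t := by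
  have hab : a ≤ b := ht.1.trans ht.2
  have ha : a ∈ Icc a b := ⟨le_rfl, hab⟩
  -- `g'` is continuous on `[a, b]`
  have hg'c : ContinuousOn g' (Icc a b) :=
    hf'g'.continuousOn (Eventually.of_forall fun n ↦ hf'c n).frequently
  -- the integrals of `fₙ'` converge to the integral of `g'`
  have hlim : ∀ u ∈ Icc a b,
      Tendsto (fun n ↦ ∫ s in a..u, f' n s) atTop (𝓝 (∫ s in a..u, g' s)) := by
    intro u hu
    rw [Metric.tendsto_nhds]
    intro ε hε
    have hε' : 0 < ε / (b - a + 1) := div_pos hε (by linarith)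
    filter_upwards [(Metric.tendstoUniformlyOn_iff.1 hf'g') _ hε'] with n hn
    have hsub : Icc a u ⊆ Icc a b := Icc_subset_Icc_right hu.2
    have hi1 : IntervalIntegrable (f' n) volume a u :=
      ((hf'c n).mono hsub).intervalIntegrable_of_Icc hu.1
    have hi2 : IntervalIntegrable g' volume a u := (hg'c.mono hsub).intervalIntegrable_of_Icc hu.1
    rw [dist_eq_norm, ← integral_sub hi1 hi2]
    have hbound : ∀ s ∈ Set.uIoc a u, ‖f' n s - g' s‖ ≤ ε / (b - a + 1) := by
      intro s hs
      rw [uIoc_of_le hu.1] at hs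
      have h := hn s ⟨hs.1.le, hs.2.trans hu.2⟩
      rw [dist_eq_norm, ← norm_neg, neg_sub] at h
      exact h.le
    calc ‖∫ s in a..u, f' n s - g' s‖ ≤ ε / (b - a + 1) * |u - a| :=
          norm_integral_le_of_norm_le_const hbound
      _ < ε := by
          rw [abs_of_nonneg (sub_nonneg.2 hu.1), div_mul_eq_mul_div, div_lt_iff₀ (by linarith)]
          nlinarith [hu.2]
  -- hence `g u = g a + ∫_a^u g'` on `[a, b]`
  have hg : ∀ u ∈ Icc a b, g u = g a + ∫ s in a..u, g' s := by
    intro u hu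
    have h1 : Tendsto (fun n ↦ f n u) atTop (𝓝 (g a + ∫ s in a..u, g' s)) := by
      have h := (hfg a ha).add (hlim u hu)
      refine h.congr fun n ↦ ?_
      exact (eq_add_integral_of_hasDerivWithinAt_Icc (hf n) (hf'c n) hu).symm
    exact tendsto_nhds_unique (hfg u hu) h1
  -- differentiate the integral within `[a, b]`
  haveI : Fact (t ∈ Icc a b) := ⟨ht⟩
  have hint : IntervalIntegrable g' volume a t :=
    (hg'c.mono (Icc_subset_Icc_right ht.2)).intervalIntegrable_of_Icc ht.1
  have hmeas : StronglyMeasurableAtFilter g' (𝓝[Icc a b] t) volume :=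
    hg'c.stronglyMeasurableAtFilter_nhdsWithin measurableSet_Icc t
  have hderiv : HasDerivWithinAt (fun u ↦ ∫ s in a..u, g' s) (g' t) (Icc a b) t :=
    integral_hasDerivWithinAt_right hint hmeas (hg'c t ht)
  have hderiv' : HasDerivWithinAt (fun u ↦ g a + ∫ s in a..u, g' s) (g' t) (Icc a b) t := by
    simpa using hderiv.const_add (g a)
  exact hderiv'.congr (fun u hu ↦ hg u hu) (hg t ht)

end OneVariable

/-! ### Space: uniform convergence of all iterated derivatives -/

section Space

omit [CompleteSpace F] in
/-- The limits of the iterated derivatives are differentiable, with derivative the (curried)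
limit of the next order. [cite: Dieudonne1960, (8.6.3)] -/
theorem hasFDerivAt_limit_iteratedFDeriv {f : ℕ → E → F} (hf : ∀ n, ContDiff ℝ ∞ (f n))
    {g : (k : ℕ) → E → ContinuousMultilinearMap ℝ (fun _ : Fin k ↦ E) F}
    (hg : ∀ k, TendstoUniformly (fun n ↦ iteratedFDeriv ℝ k (f n)) (g k) atTop) (k : ℕ) (x : E) :
    HasFDerivAt (g k)
      ((continuousMultilinearCurryLeftEquiv ℝ (fun _ : Fin (k + 1) ↦ E) F) (g (k + 1) x)) x := by
  set iso := continuousMultilinearCurryLeftEquiv ℝ (fun _ : Fin (k + 1) ↦ E) F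
  have hf' : TendstoUniformly (fun n x ↦ iso (iteratedFDeriv ℝ (k + 1) (f n) x)) (fun x ↦ iso (g (k + 1) x))
      atTop :=
    iso.toContinuousLinearEquiv.toContinuousLinearMap.uniformContinuous.comp_tendstoUniformly (hg (k + 1))
  refine hasFDerivAt_of_tendstoUniformly hf' (fun n y ↦ ?_) (fun y ↦ (hg k).tendsto_at y) x
  -- `iteratedFDeriv k (f n)` has derivative `iso (iteratedFDeriv (k+1) (f n))`
  have hd : DifferentiableAt ℝ (iteratedFDeriv ℝ k (f n)) y :=
    ((hf n).differentiable_iteratedFDeriv (m := k) (by exact_mod_cast WithTop.coe_lt_top _)) y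
  have h := hd.hasFDerivAt
  rwa [fderiv_iteratedFDeriv] at h

omit [CompleteSpace F] in
/-- **Uniform convergence of all iterated derivatives makes the limit smooth**: if the `fₙ` are
smooth, `iteratedFDeriv k (fₙ) → g k` uniformly for every `k`, and `fₙ → G` pointwise, then `G`
is smooth and `iteratedFDeriv k G = g k` for every `k`. [cite: Dieudonne1960, (8.6.3)] -/
theorem contDiff_of_tendstoUniformly_iteratedFDeriv {f : ℕ → E → F} (hf : ∀ n, ContDiff ℝ ∞ (f n))
    {g : (k : ℕ) → E → ContinuousMultilinearMap ℝ (fun _ : Fin k ↦ E) F}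
    (hg : ∀ k, TendstoUniformly (fun n ↦ iteratedFDeriv ℝ k (f n)) (g k) atTop) {G : E → F}
    (hG : ∀ x, Tendsto (fun n ↦ f n x) atTop (𝓝 (G x))) :
    ContDiff ℝ ∞ G ∧ ∀ k, iteratedFDeriv ℝ k G = g k := by
  -- order zero: `g 0 = iteratedFDeriv 0 G`
  have h0 : iteratedFDeriv ℝ 0 G = g 0 := by
    funext x
    have h1 : Tendsto (fun n ↦ iteratedFDeriv ℝ 0 (f n) x) atTop (𝓝 (g 0 x)) := (hg 0).tendsto_at x
    have h2 : Tendsto (fun n ↦ iteratedFDeriv ℝ 0 (f n) x) atTop (𝓝 (iteratedFDeriv ℝ 0 G x)) := by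
      simp only [iteratedFDeriv_zero_eq_comp, comp_apply]
      exact ((continuousMultilinearCurryFin0 ℝ E F).symm.continuous.tendsto _).comp (hG x)
    exact tendsto_nhds_unique h2 h1
  -- all orders, by induction
  have hall : ∀ k, iteratedFDeriv ℝ k G = g k := by
    intro k
    induction k with
    | zero => exact h0
    | succ k ih =>
      rw [iteratedFDeriv_succ_eq_comp_left, ih]
      funext x
      simp only [comp_apply]
      rw [(hasFDerivAt_limit_iteratedFDeriv hf hg k x).fderiv]
      exact (continuousMultilinearCurryLeftEquiv ℝ (fun _ : Fin (k + 1) ↦ E) F).symm_apply_apply _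
  refine ⟨contDiff_of_differentiable_iteratedFDeriv fun m _ ↦ ?_, hall⟩
  rw [hall m]
  exact fun x ↦ (hasFDerivAt_limit_iteratedFDeriv hf hg m x).differentiableAt

end Space

/-! ### The slab: limits of families with the mixed-partials structure -/

section Slab

/-- **Uniform limits of slab-smooth families.** Let `w N l : ℝ → E → F` (`N` the sequence index,
`l` the order of the time derivative) be families on the slab `I × E`, `I = [a, b]`, with: slices
smooth, `∂ₜ` of every spatial derivative of `w N l` within `I` equal to that of `w N (l+1)`,
all mixed derivatives jointly continuous on the slab, and all mixed derivatives uniformly Cauchy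
on the slab. Then there is a limit family `W l` with the same structure, smooth on the closed slab,
to whose mixed derivatives those of `w N` converge uniformly on the slab.
[cite: Dieudonne1960, (8.6.3)–(8.6.4)] -/
theorem slab_uniform_limit {a b : ℝ} (hab : a < b) {w : ℕ → ℕ → ℝ → E → F}
    (hx : ∀ N l, ∀ t ∈ Icc a b, ContDiff ℝ ∞ (w N l t))
    (ht : ∀ N (k l : ℕ), ∀ t ∈ Icc a b, ∀ x : E,
      HasDerivWithinAt (fun τ ↦ iteratedFDeriv ℝ k (w N l τ) x)
        (iteratedFDeriv ℝ k (w N (l + 1) t) x) (Icc a b) t)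
    (hc : ∀ N (k l : ℕ), ContinuousOn (fun p : ℝ × E ↦ iteratedFDeriv ℝ k (w N l p.1) p.2)
      (Icc a b ×ˢ univ))
    (hC : ∀ k l : ℕ, UniformCauchySeqOn (fun N (p : ℝ × E) ↦ iteratedFDeriv ℝ k (w N l p.1) p.2)
      atTop (Icc a b ×ˢ univ)) :
    ∃ W : ℕ → ℝ → E → F,
      (∀ l, ContDiffOn ℝ ∞ (uncurry (W l)) (Icc a b ×ˢ univ)) ∧
      (∀ l, ∀ t ∈ Icc a b, ContDiff ℝ ∞ (W l t)) ∧
      (∀ (k l : ℕ), ∀ t ∈ Icc a b, ∀ x : E,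
        HasDerivWithinAt (fun τ ↦ iteratedFDeriv ℝ k (W l τ) x)
          (iteratedFDeriv ℝ k (W (l + 1) t) x) (Icc a b) t) ∧
      (∀ k l : ℕ, TendstoUniformlyOn (fun N (p : ℝ × E) ↦ iteratedFDeriv ℝ k (w N l p.1) p.2)
        (fun p ↦ iteratedFDeriv ℝ k (W l p.1) p.2) atTop (Icc a b ×ˢ univ)) := by
  set I := Icc a b with hI
  -- Step 1: pointwise limits of all mixed derivatives on the slab
  have hlim : ∀ (k l : ℕ) (p : ℝ × E), p ∈ I ×ˢ (univ : Set E) →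
      ∃ y, Tendsto (fun N ↦ iteratedFDeriv ℝ k (w N l p.1) p.2) atTop (𝓝 y) := fun k l p hp ↦
    cauchySeq_tendsto_of_complete ((hC k l).cauchySeq hp)
  choose! g hg using hlim
  have hgu : ∀ k l, TendstoUniformlyOn (fun N (p : ℝ × E) ↦ iteratedFDeriv ℝ k (w N l p.1) p.2)
      (g k l) atTop (I ×ˢ univ) := fun k l ↦
    (hC k l).tendstoUniformlyOn_of_tendsto fun p hp ↦ hg k l p hp
  -- the limit family: the order-zero limits
  set W : ℕ → ℝ → E → F := fun l t x ↦ (g 0 l (t, x)) (fun _ ↦ 0) with hW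
  -- Step 2: for `t ∈ I` the slices of the `w N l t` converge pointwise to `W l t`
  have hWlim : ∀ l, ∀ t ∈ I, ∀ x, Tendsto (fun N ↦ w N l t x) atTop (𝓝 (W l t x)) := by
    intro l t htI x
    have h := hg 0 l (t, x) (mk_mem_prod htI (mem_univ x))
    have h2 := ((ContinuousMultilinearMap.apply ℝ (fun _ : Fin 0 ↦ E) F fun _ ↦ 0).continuous.tendsto
      _).comp h
    exact h2.congr fun N ↦ rfl
  -- Step 3: slices of the limit are smooth with the limits as iterated derivatives
  have hslice : ∀ l, ∀ t ∈ I, ContDiff ℝ ∞ (W l t) ∧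
      ∀ k, iteratedFDeriv ℝ k (W l t) = fun x ↦ g k l (t, x) := by
    intro l t htI
    refine contDiff_of_tendstoUniformly_iteratedFDeriv (fun N ↦ hx N l t htI) (fun k ↦ ?_)
      (hWlim l t htI)
    -- uniform convergence on the slice `{t} × E`
    rw [Metric.tendstoUniformly_iff]
    intro ε hε
    filter_upwards [(Metric.tendstoUniformlyOn_iff.1 (hgu k l)) ε hε] with N hN
    exact fun x ↦ hN (t, x) (mk_mem_prod htI (mem_univ x))
  have hWiter : ∀ l k, ∀ t ∈ I, ∀ x, iteratedFDeriv ℝ k (W l t) x = g k l (t, x) :=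
    fun l k t htI x ↦ congr_fun ((hslice l t htI).2 k) x
  -- Step 4: uniform convergence of the mixed derivatives to those of `W`
  have hconv : ∀ k l : ℕ, TendstoUniformlyOn (fun N (p : ℝ × E) ↦ iteratedFDeriv ℝ k (w N l p.1) p.2)
      (fun p ↦ iteratedFDeriv ℝ k (W l p.1) p.2) atTop (I ×ˢ univ) := by
    intro k l
    refine (hgu k l).congr_right fun p hp ↦ ?_
    exact (hWiter l k p.1 (mem_prod.1 hp).1 p.2).symm
  -- Step 5: time derivatives within `I` pass to the limit
  have hWt : ∀ (k l : ℕ), ∀ t ∈ I, ∀ x : E,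
      HasDerivWithinAt (fun τ ↦ iteratedFDeriv ℝ k (W l τ) x)
        (iteratedFDeriv ℝ k (W (l + 1) t) x) I t := by
    intro k l t htI x
    have huni : ∀ l', TendstoUniformlyOn (fun N τ ↦ iteratedFDeriv ℝ k (w N l' τ) x)
        (fun τ ↦ iteratedFDeriv ℝ k (W l' τ) x) atTop I := by
      intro l'
      rw [Metric.tendstoUniformlyOn_iff]
      intro ε hε
      filter_upwards [(Metric.tendstoUniformlyOn_iff.1 (hconv k l')) ε hε] with N hN
      exact fun τ hτ ↦ hN (τ, x) (mk_mem_prod hτ (mem_univ x))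
    refine hasDerivWithinAt_of_tendstoUniformlyOn_Icc (f := fun N τ ↦ iteratedFDeriv ℝ k (w N l τ) x)
      (f' := fun N τ ↦ iteratedFDeriv ℝ k (w N (l + 1) τ) x) (fun N τ hτ ↦ ht N k l τ hτ x)
      (fun N ↦ ?_) (fun τ hτ ↦ (huni l).tendsto_at hτ) (huni (l + 1)) htI
    exact (hc N k (l + 1)).comp (continuousOn_id.prodMk continuousOn_const)
      fun τ hτ ↦ mk_mem_prod hτ (mem_univ x)
  -- Step 6: joint continuity of the mixed derivatives of the limit
  have hWc : ∀ k l : ℕ, ContinuousOn (fun p : ℝ × E ↦ iteratedFDeriv ℝ k (W l p.1) p.2) (I ×ˢ univ) :=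
    fun k l ↦ (hconv k l).continuousOn (Eventually.of_forall fun N ↦ hc N k l).frequently
  -- Step 7: smoothness on the closed slab
  have hIc : Convex ℝ I := convex_Icc a b
  have hIu : UniqueDiffOn ℝ I := uniqueDiffOn_Icc hab
  refine ⟨W, fun l ↦ ?_, fun l t htI ↦ (hslice l t htI).1, hWt, hconv⟩
  exact contDiffOn_uncurry_of_mixed_partials_within hIc hIu (fun l t htI ↦ (hslice l t htI).1)
    hWt hWc l

end Slab

end Literature.Analysis.Calculus

end
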